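import Summits.CriticalPhenomena.PercolationContinuityZ3.Theorems.PercNearOneGluingNoHeavyQuantBlockCombGeneralRow
import Summits.CriticalPhenomena.PercolationContinuityZ3.Theorems.PercNearOneGluingNoHeavyQuantIndepBlobOneLight
import HarnessLib

/-!
# QUANT lane R8, FAR on trees: "D-ROOT" in the canonical block-comb model — a block-comb plus ONE LIGHT ROOT BLOB (private gate below the
# chain floor), credited at the discounted rate `a·(g − x²)/(1 − x)`, for every floor with `x³ + x ≥ 1`

builds on p205010 (kernel theorem, internal audit signed; external expert review pending)

Support file (`--supports stmt-CriticalPhenomena-4575`), QUANT lane census seat prim-quant-census-1 (gen 14), rung R8 of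
`run/shared/lean/prim/quant/LADDER.md`; memo `run/shared/lean/prim/quant/prim-quant-census-1/TREES-G14.md` §4.

Canonical block-comb (`…QuantBlockCombMergeModel.lean`: chain gates `q`, floor `x = ∏_{i<D} q i`, blobs with levels `lv`, sizes `a`, private
gates `g`, marginal `(∏_{i<lv k} q)·g k`).  census-1 g13's `BlockComb.tail_ge_of_mean` is the row when EVERY live marginal is `≥ x`.  Here one
root-level blob `s` is allowed BELOW the floor (`x² ≤ g s ≤ x`, size `a s ≤ j`) and is credited at `a s·(g s − x²)/(1 − x)` — the rate of
census-2 g49's conjecture DIB\* (`prim-quant-census-2-g49/ARCH-TREES-G49.md` §1.3 "D-root", §3), which is what the general hair of LEAD-NOTES-G14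
N25 reduces to (ARCH-TREES §1.1 (B+C): the hair law is `π_B·blob ⊕ π_C·[carrier SURE ⊕ light pendant]`).

* `BlockComb.tail_ge_of_mean_lightRoot` — **floor `0 < x < 1` with `x³ + x ≥ 1` (`x ≥ 0.6824`), every live blob other than `s` has marginal
  `≥ x`, `lv s = 0`, `x² ≤ g s ≤ x`, `a s ≤ j`, and `2j < Σ_{k ≠ s} a k·marg k + a s·(g s − x²)/(1 − x)`; then `x ≤ TAIL`.**
  Proof = the dichotomy of `IndepBlob.tail_ge_of_oneLight` run in the canonical model: (G) if `g s·Σ_{k≠s} a k ≥ j` the light blob merges into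
  some live blob without raising the tail (p1 g8's `BlockComb.tail_transfer_le`), the merged block-comb is proper with budget `> 2j`, and
  `tail_ge_of_mean` applies; (M) if `EN ≥ (1 − x)j + x·n` Markov (`tail_ge_mean_markov`); (∅) otherwise `IndepBlob.oneLight_noGap` is contradicted.
[cite: KozmaNitzan2024, Conjecture 3 (p. 15)] (the gluing rows served); the row is [this work].  Theorems only (the `local notation3` of
`…QuantBlockCombMergeModel.lean`, verbatim), no sorries, standard axioms.
-/

namespace Summit.CriticalPhenomena.PercolationContinuityZ3.Theorems

namespace Quant

namespace BlockComb

open Finset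

variable {κ : Type*} [Fintype κ] [DecidableEq κ]

/-- product-Bernoulli weight of the set `S` of open blob gates -/
local notation3 "wt[" g ", " S "]" => ∏ k, (if k ∈ (S : Finset κ) then (g : κ → ℝ) k else 1 - (g : κ → ℝ) k)
/-- probability that the chain `q` of length `D` is open exactly to depth `i` -/
local notation3 "pd[" D ", " q ", " i "]" =>
  (∏ i' ∈ Finset.range (i : ℕ), (q : ℕ → ℝ) i') * (if (i : ℕ) < (D : ℕ) then 1 - (q : ℕ → ℝ) i else 1)
/-- mass counted at depth `i` in blob configuration `S` -/
local notation3 "mass[" lv ", " a ", " i ", " S "]" =>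
  ∑ k ∈ (S : Finset κ).filter (fun k => (lv : κ → ℕ) k ≤ (i : ℕ)), ((a : κ → ℕ) k : ℕ)
/-- the tail `P(N ≥ j+1)` of the block-comb count, as an explicit finite sum -/
local notation3 "TAIL[" D ", " q ", " lv ", " a ", " g ", " j "]" =>
  ∑ i ∈ Finset.range ((D : ℕ) + 1), pd[D, q, i] *
    ∑ S : Finset κ, wt[g, S] * (if (j : ℕ) + 1 ≤ mass[lv, a, i, S] then (1 : ℝ) else 0)

/-- **D-ROOT (block-comb + one light root blob, discounted credit), floors with `x³ + x ≥ 1`.**  See the module docstring. [this work] -/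
theorem tail_ge_of_mean_lightRoot (D : ℕ) (q : ℕ → ℝ) (hq : ∀ i, 0 ≤ q i ∧ q i ≤ 1) (lv : κ → ℕ) (a : κ → ℕ)
    (g : κ → ℝ) (hg : ∀ k, 0 ≤ g k ∧ g k ≤ 1) (j : ℕ) (hlv : ∀ k, 0 < a k → lv k ≤ D)
    (x : ℝ) (hx0 : 0 < x) (hx1 : x < 1) (hx3 : 1 ≤ x ^ 3 + x) (hxq : x = ∏ i ∈ Finset.range D, q i)
    (s : κ) (hs0 : lv s = 0) (hgsl : x ^ 2 ≤ g s) (hgsu : g s ≤ x) (hasj : a s ≤ j)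
    (hmarg : ∀ k, k ≠ s → 0 < a k → x ≤ (∏ i ∈ Finset.range (lv k), q i) * g k)
    (hcredit : (2 * j : ℝ) < (∑ k ∈ (Finset.univ : Finset κ).erase s, (a k : ℝ) * ((∏ i ∈ Finset.range (lv k), q i) * g k)) +
      a s * ((g s - x ^ 2) / (1 - x))) :
    x ≤ TAIL[D, q, lv, a, g, j] := by
  -- aggregate quantities
  set B : ℝ := ∑ k ∈ (Finset.univ : Finset κ).erase s, (a k : ℝ) * ((∏ i ∈ Finset.range (lv k), q i) * g k) with hB
  set C : ℝ := ∑ k ∈ (Finset.univ : Finset κ).erase s, (a k : ℝ) with hC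
  have hmargs : (∏ i ∈ Finset.range (lv s), q i) * g s = g s := by rw [hs0]; simp
  have hEN : ∑ k, (a k : ℝ) * ((∏ i ∈ Finset.range (lv k), q i) * g k) = B + a s * g s := by
    rw [← Finset.add_sum_erase _ _ (Finset.mem_univ s), hmargs, hB]; ring
  have hn : ∑ k, (a k : ℝ) = C + a s := by
    rw [← Finset.add_sum_erase _ _ (Finset.mem_univ s), hC]; ring
  have hC0 : 0 ≤ C := Finset.sum_nonneg fun k _ => Nat.cast_nonneg _
  have hBC : B ≤ C := by
    rw [hB, hC]
    refine Finset.sum_le_sum fun k _ => ?_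
    have h1 : (∏ i ∈ Finset.range (lv k), q i) * g k ≤ 1 := by
      have hp1 : ∏ i ∈ Finset.range (lv k), q i ≤ 1 := Finset.prod_le_one (fun i _ => (hq i).1) fun i _ => (hq i).2
      have hp0 : 0 ≤ ∏ i ∈ Finset.range (lv k), q i := Finset.prod_nonneg fun i _ => (hq i).1
      nlinarith [(hg k).1, (hg k).2]
    have : (0 : ℝ) ≤ a k := Nat.cast_nonneg _
    nlinarith
  have hkappa : (g s - x ^ 2) / (1 - x) ≤ x := by
    rw [div_le_iff₀ (by linarith)]; nlinarith
  have hb0 : (0 : ℝ) ≤ a s := Nat.cast_nonneg _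
  have hbj' : ((a s : ℕ) : ℝ) ≤ j := by exact_mod_cast hasj
  have hg0 : 0 ≤ g s := (hg s).1
  -- total mass exceeds `j`
  have hAj : (j : ℝ) < C + a s := by
    have h1 : (a s : ℝ) * ((g s - x ^ 2) / (1 - x)) ≤ a s * x := mul_le_mul_of_nonneg_left hkappa hb0
    have h2 : (a s : ℝ) * x ≤ a s := by nlinarith
    have hj0 : (0 : ℝ) ≤ j := Nat.cast_nonneg _
    linarith
  by_cases hM : (1 - x) * j + x * (C + a s) ≤ B + a s * g s
  · -- (M) Markov on the closed mass
    have hnj : (j : ℝ) < ∑ k, (a k : ℝ) := by rw [hn]; exact hAj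
    have hmk := tail_ge_mean_markov D q hq lv a g hg j hlv hnj
    refine le_trans ?_ hmk
    rw [hEN, hn, le_div_iff₀ (by linarith)]
    linarith
  by_cases hG : (j : ℝ) ≤ g s * C
  · -- (G) merge the light blob into some live blob, then the proper row `tail_ge_of_mean`
    have hupd : ∀ k, ((Function.update a s 0 k : ℕ) : ℝ) = if k = s then 0 else (a k : ℝ) := by
      intro k; rw [Function.update_apply]; split_ifs <;> simp
    have hsumupd : ∑ k, ((Function.update a s 0 k : ℕ) : ℝ) = C := by
      rw [Finset.sum_congr rfl fun k _ => hupd k, ← Finset.add_sum_erase _ _ (Finset.mem_univ s), if_pos rfl, zero_add, hC]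
      refine Finset.sum_congr rfl fun k hk => ?_
      rw [if_neg (Finset.ne_of_mem_erase hk)]
    have hpos : ∃ k, 0 < Function.update a s 0 k := by
      by_contra hnone
      push Not at hnone
      have hC0' : C = 0 := by
        rw [← hsumupd]; exact Finset.sum_eq_zero fun k _ => by simp [Nat.le_zero.mp (hnone k)]
      have hgpos : 0 < g s := lt_of_lt_of_le (by positivity) hgsl
      have hj0 : (0 : ℝ) ≤ j := Nat.cast_nonneg _
      have : (j : ℝ) ≤ 0 := by rw [hC0', mul_zero] at hG; exact hG
      have hj00 : (j : ℝ) = 0 := le_antisymm this hj0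
      have h1 : (a s : ℝ) * ((g s - x ^ 2) / (1 - x)) ≤ a s * x := mul_le_mul_of_nonneg_left hkappa hb0
      have hB0 : B ≤ 0 := by rw [← hC0']; exact hBC
      nlinarith
    obtain ⟨ℓ, hℓ, hle⟩ := tail_transfer_le D q hq lv a g hg j s hs0 (by rw [hsumupd]; exact hG) hpos
    have hℓs : ℓ ≠ s := by
      intro h; rw [h, Function.update_self] at hℓ; exact lt_irrefl _ hℓ
    have haℓ : 0 < a ℓ := by rwa [Function.update_of_ne hℓs] at hℓ
    refine le_trans ?_ hle
    -- the merged block-comb: sizes `a' = a[s ↦ 0][ℓ ↦ a ℓ + a s]`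
    set a' : κ → ℕ := Function.update (Function.update a s 0) ℓ (Function.update a s 0 ℓ + a s) with ha'
    have ha'app : ∀ k, a' k = if k = ℓ then a ℓ + a s else if k = s then 0 else a k := by
      intro k
      rw [ha', Function.update_apply]
      split_ifs with h1 h2
      · rw [Function.update_of_ne hℓs]
      · subst h2; rw [Function.update_self]
      · rw [Function.update_of_ne h2]
    have hlv' : ∀ k, 0 < a' k → lv k ≤ D := by
      intro k hk
      rw [ha'app k] at hk
      split_ifs at hk with h1 h2
      · subst h1; exact hlv _ haℓ
      · exact absurd hk (lt_irrefl 0)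
      · exact hlv k hk
    have hmarg' : ∀ k, 0 < a' k → x ≤ (∏ i ∈ Finset.range (lv k), q i) * g k := by
      intro k hk
      rw [ha'app k] at hk
      split_ifs at hk with h1 h2
      · subst h1; exact hmarg _ hℓs haℓ
      · exact absurd hk (lt_irrefl 0)
      · exact hmarg k h2 hk
    have hbudget' : (2 * j : ℝ) < ∑ k, (a' k : ℝ) * ((∏ i ∈ Finset.range (lv k), q i) * g k) := by
      have e : ∑ k, (a' k : ℝ) * ((∏ i ∈ Finset.range (lv k), q i) * g k) =
          B + (a s : ℝ) * ((∏ i ∈ Finset.range (lv ℓ), q i) * g ℓ) := by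
        have h' : ∀ k, (a' k : ℝ) * ((∏ i ∈ Finset.range (lv k), q i) * g k) =
            (if k = s then 0 else (a k : ℝ) * ((∏ i ∈ Finset.range (lv k), q i) * g k)) +
              (if k = ℓ then (a s : ℝ) * ((∏ i ∈ Finset.range (lv ℓ), q i) * g ℓ) else 0) := by
          intro k
          rw [ha'app k]
          by_cases h1 : k = ℓ
          · subst h1; rw [if_pos rfl, if_neg hℓs, if_pos rfl]; push_cast; ring
          · rw [if_neg h1, if_neg h1]
            by_cases h2 : k = s
            · rw [if_pos h2, if_pos h2]; simp
            · rw [if_neg h2, if_neg h2]; simp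
        rw [Finset.sum_congr rfl fun k _ => h' k, Finset.sum_add_distrib, Finset.sum_ite_eq' Finset.univ ℓ, if_pos (Finset.mem_univ _),
          ← Finset.add_sum_erase _ _ (Finset.mem_univ s), if_pos rfl, zero_add, hB]
        congr 1
        exact Finset.sum_congr rfl fun k hk => by rw [if_neg (Finset.ne_of_mem_erase hk)]
      rw [e]
      have h1 : (a s : ℝ) * ((g s - x ^ 2) / (1 - x)) ≤ a s * x := mul_le_mul_of_nonneg_left hkappa hb0
      have h2 : (a s : ℝ) * x ≤ a s * ((∏ i ∈ Finset.range (lv ℓ), q i) * g ℓ) := mul_le_mul_of_nonneg_left (hmarg ℓ hℓs haℓ) hb0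
      linarith
    exact tail_ge_of_mean D q hq lv a' g hg j hlv' x hx0 hxq hmarg' hbudget'
  · -- (∅) the third case is empty
    exfalso
    push Not at hM hG
    have hgpos : 0 < g s := lt_of_lt_of_le (by positivity) hgsl
    have h1x : 0 < 1 - x := by linarith
    have hcr : (2 : ℝ) * j * (1 - x) < B * (1 - x) + a s * (g s - x ^ 2) := by
      have e : (B + a s * ((g s - x ^ 2) / (1 - x))) * (1 - x) = B * (1 - x) + a s * (g s - x ^ 2) := by
        field_simp
      have := mul_lt_mul_of_pos_right hcredit h1x
      linarith
    have P1 : (B + a s * g s) * (1 - x) * g s < ((1 - x) * j + x * (C + a s)) * (1 - x) * g s :=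
      mul_lt_mul_of_pos_right (mul_lt_mul_of_pos_right hM h1x) hgpos
    have P2 : x * (1 - x) * (g s * C) < x * (1 - x) * j := mul_lt_mul_of_pos_left hG (mul_pos hx0 h1x)
    have P3 : (2 : ℝ) * j * (1 - x) * g s < (B * (1 - x) + a s * (g s - x ^ 2)) * g s := mul_lt_mul_of_pos_right hcr hgpos
    have hlt : (j : ℝ) * (1 - x) * (g s * (1 + x) - x) < a s * x * g s * (1 - 2 * x + g s) := by
      nlinarith [P1, P2, P3]
    have hng := IndepBlob.oneLight_noGap x (g s) (a s) j hx0 hx1 hx3 hgsl hgsu hb0 hbj'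
    linarith

end BlockComb

end Quant

end Summit.CriticalPhenomena.PercolationContinuityZ3.Theorems
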